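/-
Copyright: fleet lead `ym-wcr-19456-p1` (seat prover-ym-wcr-19456-p1-g0-0), route `WeakCouplingRates`, crux
`ColdBoxTwoPointFloor` (stmt-QuantumFields-19456), toward stub S3c `stub_boxGaussianDomination` (piece S3c-i, `SU(2)` form).
-/
import Summits.QuantumFields.YangMills.Theorems.WeakCouplingRatesColdBoxLargeField
import Literature.MathematicalPhysics.QuantumFieldTheory.Balaban1983to89.HaarSmallBallClosedSubgroup

/-!
# Crux `ColdBoxTwoPointFloor`, piece S3c-i for the `SU(2)` cold box: `boxState{∃ large plaquette} ≤ exp(−β^ε)`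
# for box half-side `⌈β^θ⌉` and threshold `β^{2ε−1}`, `ε > 2θ`

The `SU(2)` specialisation of the Gibbs–Laplace bound `ymSpecification_one_real_le` of the sibling file
`WeakCouplingRatesColdBoxLargeField` to the cold-wall box state `boxState (fundamentalRep (Fin 2)) β H` of the leaf
module (radius `r = β^{−1/2}`, small balls of `SU(2)` from the tree's
`HaarSmallBallClosedSubgroup.haar_ball_ge_specialUnitaryGroup`, exponent `dim SU(2) = 3`):

* `exists_boxState_real_le` — `boxState(E) ≤ e^{−βs₀}·e^{16·#Λ'}·(c(√β)³)^{#Λ}` whenever `S_Λ ≥ s₀` on `E`,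
  `Λ = boxEdges 4 (2H+1)`, one constant `c > 0`, all `β ≥ 1`, all `H`;
* `exists_boxState_largeField_le` — the same for the event «some plaquette touching `Λ` has cost `2 − Re tr U_p ≥ s`»
  (`measurableSet_exists_plaqCost_ge`, `le_wilsonBoundaryAction_of_exists_plaqCost_ge`);
* `eventually_neg_rpow_add_le` — the elementary asymptotics `−β^{2ε} + Aβ^{4θ} + Bβ^{4θ}log β ≤ −β^ε` eventually, for
  `2θ < ε`;
* `boxState_largeField_rarity` — **S3c-i(θ, ε)**: for `0 < θ < ε/2`, eventually in `β`,
  `boxState_{⌈β^θ⌉}{∃ p touching the box : cost_p ≥ β^{2ε−1}} ≤ exp(−β^ε)`.  The constraint `ε > 2θ` (the `#Λ ≍ β^{4θ}`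
  links each cost `(3/2)log β` in the normaliser, against the gain `β·β^{2ε−1}`) is the first exponent constraint of the
  one-scale window for S3c recorded in the line card; inside it large fields are negligible against the signal
  `β²·Cov ≍ β^{−8A}` of the crux for every `A` (super-polynomial smallness).

Everything is proved; no definition, no named fact; standard axioms.  NOT a statement about the mass gap.
-/

set_option autoImplicit false

noncomputable section

open MeasureTheory Finset
open scoped Matrix.Norms.L2Operator
open Literature.Probability.LatticeModels (glueWith glueWith_apply_mem glueWith_apply_not_mem
  measurable_glueWith)
open Literature.MathematicalPhysics.QuantumLattice
open Literature.MathematicalPhysics.QuantumFieldTheory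
open Literature.MathematicalPhysics.QuantumFieldTheory.Balaban1983to89.UnitaryModel
open Literature.MathematicalPhysics.QuantumFieldTheory.PlaquetteTail

namespace Summit.QuantumFields.YangMills.Theorems.WeakCouplingRates

/-! ## The `SU(2)` cold-wall box: the large-field bound with `r = β^{-1/2}` -/

section SU2Box

open Literature.MathematicalPhysics.QuantumFieldTheory.Balaban1983to89.HaarSmallBallClosedSubgroup
  (haar_ball_ge_specialUnitaryGroup)

/-- `SU(2)` is second countable (a subtype of `M₂(ℂ)`). -/
theorem secondCountableTopology_SU2 : SecondCountableTopology (Matrix.specialUnitaryGroup (Fin 2) ℂ) := by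
  haveI := Balaban1983to89.secondCountableTopology_matrix (n := Fin 2)
  exact Topology.IsEmbedding.subtypeVal.secondCountableTopology

/-- `#E_n ≤ 4 n⁴` for the edges of the vertex box `{0,…,n-1}⁴`. -/
theorem card_boxEdges_four_le (n : ℕ) : #(AxialGauge.boxEdges 4 n) ≤ 4 * n ^ 4 := by
  rw [AxialGauge.card_boxEdges]
  have h : (n - 1) * n ^ (4 - 1) ≤ n ^ 4 := by
    calc (n - 1) * n ^ (4 - 1) ≤ n * n ^ 3 := Nat.mul_le_mul (Nat.sub_le n 1) le_rfl
      _ = n ^ 4 := by ring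
  omega

/-- `#Λ' ≤ 120 n⁴` for the plaquettes touching the edges of the vertex box `{0,…,n-1}⁴`. -/
theorem card_plaquettesTouching_boxEdges_le (n : ℕ) :
    #(plaquettesTouching (AxialGauge.boxEdges 4 n)) ≤ 120 * n ^ 4 := by
  have h1 := card_plaquettesTouching_le (AxialGauge.boxEdges 4 n)
  have h2 := card_boxEdges_four_le n
  have hc : Fintype.card {p : Fin 4 × Fin 4 // p.1 < p.2} = 6 := by decide
  rw [hc] at h1
  calc #(plaquettesTouching (AxialGauge.boxEdges 4 n)) ≤ (#(AxialGauge.boxEdges 4 n) + #(AxialGauge.boxEdges 4 n) * 4) * 6 := h1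
    _ = 30 * #(AxialGauge.boxEdges 4 n) := by ring
    _ ≤ 30 * (4 * n ^ 4) := Nat.mul_le_mul_left _ h2
    _ = 120 * n ^ 4 := by ring

/-- **The Gibbs large-field bound in the `SU(2)` cold-wall box, radius `r = β^{-1/2}`.**  There is `c > 0` (the
inverse of the tree's `SU(2)` small-ball constant) such that for every half-side `H`, every `β ≥ 1`, every measurable
event `E` on which the boundary Wilson action of `Λ = boxEdges 4 (2H+1)` is at least `s₀`:
`boxState(E) ≤ e^{−βs₀} · e^{16·#Λ'} · (c·(√β)³)^{#Λ}`. -/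
theorem exists_boxState_real_le :
    ∃ c : ℝ, 0 < c ∧ ∀ (H : ℕ) (β : ℝ), 1 ≤ β →
      ∀ (E : Set (LGConfig 4 (Matrix.specialUnitaryGroup (Fin 2) ℂ))), MeasurableSet E → ∀ (s₀ : ℝ),
        (∀ U ∈ E, s₀ ≤ wilsonBoundaryAction (fundamentalRep (Fin 2)) (AxialGauge.boxEdges 4 (2 * H + 1)) U) →
        (boxState (fundamentalRep (Fin 2)) β H).real E ≤
          Real.exp (-(β * s₀)) * Real.exp (16 * #(plaquettesTouching (AxialGauge.boxEdges 4 (2 * H + 1)))) *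
            (c * Real.sqrt β ^ 3) ^ #(AxialGauge.boxEdges 4 (2 * H + 1)) := by
  haveI := secondCountableTopology_SU2
  obtain ⟨c, hc, -, hball⟩ := haar_ball_ge_specialUnitaryGroup (n := Fin 2) (R := 1) one_pos
  refine ⟨c⁻¹, by positivity, ?_⟩
  intro H β hβ E hE s₀ hs
  set ρ := fundamentalRep (Fin 2) with hρ
  set Λ := AxialGauge.boxEdges 4 (2 * H + 1) with hΛ
  have hβ0 : 0 < β := one_pos.trans_le hβ
  -- radius and small-ball constant
  set q : ℝ := Real.sqrt β with hq
  have hq1 : 1 ≤ q := by rw [hq]; exact Real.one_le_sqrt.2 hβ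
  have hq0 : 0 < q := one_pos.trans_le hq1
  set r : ℝ := q⁻¹ with hr
  have hr0 : 0 < r := inv_pos.2 hq0
  have hr1 : r ≤ 1 := inv_le_one_of_one_le₀ hq1
  have hr2 : β * r ^ 2 = 1 := by
    rw [hr, inv_pow, hq, Real.sq_sqrt hβ0.le, mul_inv_cancel₀ hβ0.ne']
  haveI : (haarProbability (Matrix.specialUnitaryGroup (Fin 2) ℂ)).IsMulLeftInvariant := by
    unfold haarProbability; infer_instance
  have hb := hball (haarProbability (Matrix.specialUnitaryGroup (Fin 2) ℂ)) r hr0 hr1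
  rw [Fintype.card_fin] at hb
  norm_num at hb
  have hcb : 0 < c * r ^ 3 := by positivity
  have hball' : c * r ^ 3 ≤ (haarProbability (Matrix.specialUnitaryGroup (Fin 2) ℂ)).real
      {g | ‖ρ g - 1‖ ≤ r} := by
    rw [measureReal_def]
    refine (ENNReal.ofReal_le_iff_le_toReal (measure_ne_top _ _)).1 ?_
    simpa only [hρ, fundamentalRep_apply] using hb
  have key := ymSpecification_one_real_le ρ fundamentalRep_mem_unitaryGroup (continuous_fundamentalRep (Fin 2))
    hβ0.le Λ hE hs hr0.le hcb hball'
  have hbox : boxState ρ β H = ymSpecification ρ β Λ (fun _ => 1) := rfl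
  rw [hbox]
  refine key.trans (le_of_eq ?_)
  -- bookkeeping
  have e1 : β * (#(plaquettesTouching Λ) * (8 * ((2 : ℕ) : ℝ) * r ^ 2)) = 16 * #(plaquettesTouching Λ) := by
    have : β * (#(plaquettesTouching Λ) * (8 * ((2 : ℕ) : ℝ) * r ^ 2)) = 16 * #(plaquettesTouching Λ) * (β * r ^ 2) := by
      push_cast; ring
    rw [this, hr2, mul_one]
  have e2 : (c * r ^ 3)⁻¹ = c⁻¹ * q ^ 3 := by
    rw [hr, inv_pow, mul_inv, inv_inv]
  rw [e1, div_eq_mul_inv, ← inv_pow, e2]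

/-- The large-field event «some plaquette touching `Λ` costs at least `s`» is measurable. -/
theorem measurableSet_exists_plaqCost_ge (Λ : Finset (Literature.MathematicalPhysics.QuantumLattice.ZdEdge 4)) (s : ℝ) :
    MeasurableSet {U : LGConfig 4 (Matrix.specialUnitaryGroup (Fin 2) ℂ) |
      ∃ p ∈ plaquettesTouching Λ, s ≤ (2 : ℝ) - plaquetteObs (fundamentalRep (Fin 2)) p.1 p.2.1.1 p.2.1.2 U} := by
  haveI := secondCountableTopology_SU2
  have hset : {U : LGConfig 4 (Matrix.specialUnitaryGroup (Fin 2) ℂ) |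
      ∃ p ∈ plaquettesTouching Λ, s ≤ (2 : ℝ) - plaquetteObs (fundamentalRep (Fin 2)) p.1 p.2.1.1 p.2.1.2 U} =
      ⋃ p ∈ plaquettesTouching Λ, {U | s ≤ (2 : ℝ) - plaquetteObs (fundamentalRep (Fin 2)) p.1 p.2.1.1 p.2.1.2 U} := by
    ext U; simp
  rw [hset]
  refine Finset.measurableSet_biUnion _ fun p _ => measurableSet_le measurable_const ?_
  have hc : Continuous fun U : LGConfig 4 (Matrix.specialUnitaryGroup (Fin 2) ℂ) =>
      (2 : ℝ) - plaquetteObs (fundamentalRep (Fin 2)) p.1 p.2.1.1 p.2.1.2 U := by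
    have hρc := continuous_fundamentalRep (Fin 2)
    unfold plaquetteObs plaquetteHolonomyZd
    fun_prop
  exact hc.measurable

/-- On the large-field event the boundary Wilson action is at least `s`. -/
theorem le_wilsonBoundaryAction_of_exists_plaqCost_ge {Λ : Finset (Literature.MathematicalPhysics.QuantumLattice.ZdEdge 4)} {s : ℝ}
    {U : LGConfig 4 (Matrix.specialUnitaryGroup (Fin 2) ℂ)}
    (hU : ∃ p ∈ plaquettesTouching Λ, s ≤ (2 : ℝ) - plaquetteObs (fundamentalRep (Fin 2)) p.1 p.2.1.1 p.2.1.2 U) :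
    s ≤ wilsonBoundaryAction (fundamentalRep (Fin 2)) Λ U := by
  obtain ⟨p, hp, hsp⟩ := hU
  have h := plaqTerm_le_wilsonBoundaryAction (fundamentalRep (Fin 2)) fundamentalRep_mem_unitaryGroup hp U
  push_cast at h
  linarith

/-- **Large fields in the `SU(2)` cold-wall box (explicit form).**  With the constant `c` of `exists_boxState_real_le`:
for `β ≥ 1`, `s ≥ 0` and every half-side `H`,
`boxState{∃ p touching Λ : cost_p ≥ s} ≤ e^{−βs} · e^{16·#Λ'} · (c(√β)³)^{#Λ}`, `Λ = boxEdges 4 (2H+1)`. -/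
theorem exists_boxState_largeField_le :
    ∃ c : ℝ, 0 < c ∧ ∀ (H : ℕ) (β : ℝ), 1 ≤ β → ∀ (s : ℝ),
      (boxState (fundamentalRep (Fin 2)) β H).real
          {U | ∃ p ∈ plaquettesTouching (AxialGauge.boxEdges 4 (2 * H + 1)),
            s ≤ (2 : ℝ) - plaquetteObs (fundamentalRep (Fin 2)) p.1 p.2.1.1 p.2.1.2 U} ≤
        Real.exp (-(β * s)) * Real.exp (16 * #(plaquettesTouching (AxialGauge.boxEdges 4 (2 * H + 1)))) *
          (c * Real.sqrt β ^ 3) ^ #(AxialGauge.boxEdges 4 (2 * H + 1)) := by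
  obtain ⟨c, hc, h⟩ := exists_boxState_real_le
  exact ⟨c, hc, fun H β hβ s => h H β hβ _ (measurableSet_exists_plaqCost_ge _ s) s
    fun U hU => le_wilsonBoundaryAction_of_exists_plaqCost_ge hU⟩

/-! ## The asymptotic form used by the one-scale line: S3c-i(θ, ε) -/

/-- Elementary asymptotics behind S3c-i: for `0 < θ`, `2θ < ε` and any constants, eventually
`−β^{2ε} + A·β^{4θ} + B·β^{4θ}·log β ≤ −β^ε`. -/
theorem eventually_neg_rpow_add_le {θ ε : ℝ} (hθ : 0 < θ) (hε : 2 * θ < ε) (A B : ℝ) (hA : 0 ≤ A) (hB : 0 ≤ B) :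
    ∃ β₀ : ℝ, 1 ≤ β₀ ∧ ∀ β : ℝ, β₀ ≤ β →
      -(β ^ (2 * ε)) + A * β ^ (4 * θ) + B * β ^ (4 * θ) * Real.log β ≤ -(β ^ ε) := by
  set κ : ℝ := ε - 2 * θ with hκ
  have hκ0 : 0 < κ := by rw [hκ]; linarith
  set K : ℝ := A + B / κ + 1 with hK
  have hev : ∀ᶠ β : ℝ in Filter.atTop, K ≤ β ^ κ := (tendsto_rpow_atTop hκ0).eventually_ge_atTop K
  obtain ⟨b, hb⟩ := Filter.eventually_atTop.1 hev
  refine ⟨max b 1, le_max_right _ _, fun β hβ => ?_⟩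
  have hβ1 : 1 ≤ β := (le_max_right _ _).trans hβ
  have hβ0 : 0 < β := one_pos.trans_le hβ1
  have hKβ : K ≤ β ^ κ := hb β ((le_max_left _ _).trans hβ)
  -- exponents
  have eγ : β ^ (4 * θ) * β ^ κ = β ^ (ε + 2 * θ) := by
    rw [← Real.rpow_add hβ0]; congr 1; rw [hκ]; ring
  have e2 : β ^ (ε + 2 * θ) * β ^ κ = β ^ (2 * ε) := by
    rw [← Real.rpow_add hβ0]; congr 1; rw [hκ]; ring
  have hlog : Real.log β ≤ β ^ κ / κ := Real.log_le_rpow_div hβ0.le hκ0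
  have hlog0 : 0 ≤ Real.log β := Real.log_nonneg hβ1
  have hκ1 : 1 ≤ β ^ κ := Real.one_le_rpow hβ1 hκ0.le
  have hY0 : 0 ≤ β ^ (4 * θ) := Real.rpow_nonneg hβ0.le _
  have hεγ : β ^ ε ≤ β ^ (ε + 2 * θ) := Real.rpow_le_rpow_of_exponent_le hβ1 (by linarith)
  -- A Y + B Y log β ≤ (A + B/κ) Y β^κ
  have h1 : A * β ^ (4 * θ) + B * β ^ (4 * θ) * Real.log β ≤ (A + B / κ) * (β ^ (4 * θ) * β ^ κ) := by
    have hA' : A * β ^ (4 * θ) ≤ A * (β ^ (4 * θ) * β ^ κ) := by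
      refine mul_le_mul_of_nonneg_left ?_ hA
      calc β ^ (4 * θ) = β ^ (4 * θ) * 1 := (mul_one _).symm
        _ ≤ β ^ (4 * θ) * β ^ κ := mul_le_mul_of_nonneg_left hκ1 hY0
    have hB' : B * β ^ (4 * θ) * Real.log β ≤ B / κ * (β ^ (4 * θ) * β ^ κ) := by
      calc B * β ^ (4 * θ) * Real.log β ≤ B * β ^ (4 * θ) * (β ^ κ / κ) :=
            mul_le_mul_of_nonneg_left hlog (mul_nonneg hB hY0)
        _ = B / κ * (β ^ (4 * θ) * β ^ κ) := by field_simp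
    linarith
  rw [eγ] at h1
  -- (A + B/κ + 1) β^γ ≤ β^κ β^γ = β^{2ε}
  have h2 : K * β ^ (ε + 2 * θ) ≤ β ^ (2 * ε) := by
    rw [← e2, mul_comm (β ^ (ε + 2 * θ))]
    exact mul_le_mul_of_nonneg_right hKβ (Real.rpow_nonneg hβ0.le _)
  rw [hK] at h2
  nlinarith [h1, h2, hεγ, Real.rpow_nonneg hβ0.le (ε + 2 * θ)]

/-- **S3c-i (large fields are rare in the cold box, one-scale form).**  For `0 < θ` and `ε > 2θ`: for all large `β`,
in the cold-wall `SU(2)` box of half-side `⌈β^θ⌉`, the probability that SOME plaquette touching the box costs at least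
`β^{2ε−1}` (i.e. `‖U_p − 1‖ ≳ β^{ε−1/2}`, `β^{ε}` standard deviations of the Gaussian scale `β^{−1/2}`) is at most
`exp(−β^ε)`.  The threshold `ε > 2θ` is the price of the union-free but volume-dependent Gibbs bound (`#Λ ≍ β^{4θ}` links,
each costing `(3/2)·log β` in the normaliser); it is the first of the exponent constraints of the one-scale window. -/
theorem boxState_largeField_rarity {θ ε : ℝ} (hθ : 0 < θ) (hε : 2 * θ < ε) :
    ∃ β₀ : ℝ, ∀ β : ℝ, β₀ ≤ β →
      (boxState (fundamentalRep (Fin 2)) β ⌈β ^ θ⌉₊).real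
          {U | ∃ p ∈ plaquettesTouching (AxialGauge.boxEdges 4 (2 * ⌈β ^ θ⌉₊ + 1)),
            β ^ (2 * ε - 1) ≤ (2 : ℝ) - plaquetteObs (fundamentalRep (Fin 2)) p.1 p.2.1.1 p.2.1.2 U} ≤
        Real.exp (-(β ^ ε)) := by
  obtain ⟨c, hc, hmain⟩ := exists_boxState_largeField_le
  -- constants: #Λ' ≤ 120 n⁴ ≤ 75000 β^{4θ}, #Λ ≤ 4 n⁴ ≤ 2500 β^{4θ}, log(c (√β)³) ≤ |log c| + (3/2) log β
  obtain ⟨β₀, hβ₀1, hasy⟩ := eventually_neg_rpow_add_le hθ hε (16 * 75000 + 2500 * |Real.log c|) (2500 * (3 / 2))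
    (by positivity) (by positivity)
  refine ⟨β₀, fun β hβ => ?_⟩
  have hβ1 : 1 ≤ β := hβ₀1.trans hβ
  have hβ0 : 0 < β := one_pos.trans_le hβ1
  refine (hmain ⌈β ^ θ⌉₊ β hβ1 (β ^ (2 * ε - 1))).trans ?_
  set n : ℕ := 2 * ⌈β ^ θ⌉₊ + 1 with hn
  set Λ := AxialGauge.boxEdges 4 n with hΛ
  -- the box side in terms of β^θ
  have hX1 : 1 ≤ β ^ θ := Real.one_le_rpow hβ1 hθ.le
  have hnR : (n : ℝ) ≤ 5 * β ^ θ := by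
    have hc' : (⌈β ^ θ⌉₊ : ℝ) < β ^ θ + 1 := Nat.ceil_lt_add_one (by linarith)
    rw [hn]; push_cast; nlinarith
  have hn4 : (n : ℝ) ^ 4 ≤ 625 * β ^ (4 * θ) := by
    have e4 : β ^ (4 * θ) = (β ^ θ) ^ 4 := by
      rw [← Real.rpow_natCast (β ^ θ) 4, ← Real.rpow_mul hβ0.le]; norm_num; ring_nf
    rw [e4]
    calc (n : ℝ) ^ 4 ≤ (5 * β ^ θ) ^ 4 := pow_le_pow_left₀ (by positivity) hnR 4
      _ = 625 * (β ^ θ) ^ 4 := by ring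
  have hΛR : (#Λ : ℝ) ≤ 2500 * β ^ (4 * θ) := by
    have h := card_boxEdges_four_le n
    calc (#Λ : ℝ) ≤ ((4 * n ^ 4 : ℕ) : ℝ) := by rw [hΛ]; exact_mod_cast h
      _ = 4 * (n : ℝ) ^ 4 := by push_cast; ring
      _ ≤ 4 * (625 * β ^ (4 * θ)) := by linarith
      _ = 2500 * β ^ (4 * θ) := by ring
  have hΛ'R : (#(plaquettesTouching Λ) : ℝ) ≤ 75000 * β ^ (4 * θ) := by
    have h := card_plaquettesTouching_boxEdges_le n
    calc (#(plaquettesTouching Λ) : ℝ) ≤ ((120 * n ^ 4 : ℕ) : ℝ) := by rw [hΛ]; exact_mod_cast h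
      _ = 120 * (n : ℝ) ^ 4 := by push_cast; ring
      _ ≤ 120 * (625 * β ^ (4 * θ)) := by linarith
      _ = 75000 * β ^ (4 * θ) := by ring
  -- the base c (√β)³ as an exponential
  set a : ℝ := c * Real.sqrt β ^ 3 with ha
  have ha0 : 0 < a := by positivity
  have hloga : Real.log a ≤ |Real.log c| + 3 / 2 * Real.log β := by
    rw [ha, Real.log_mul hc.ne' (by positivity), Real.log_pow, Real.log_sqrt hβ0.le]
    have := le_abs_self (Real.log c)
    push_cast; linarith
  have hpow : a ^ #Λ = Real.exp (#Λ * Real.log a) := by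
    rw [Real.exp_nat_mul, Real.exp_log ha0]
  have hs : β * β ^ (2 * ε - 1) = β ^ (2 * ε) := by
    rw [show β * β ^ (2 * ε - 1) = β ^ (1 : ℝ) * β ^ (2 * ε - 1) by rw [Real.rpow_one],
      ← Real.rpow_add hβ0]; congr 1; ring
  rw [hpow, ← Real.exp_add, ← Real.exp_add, hs]
  refine Real.exp_le_exp.2 ?_
  have hlog0 : 0 ≤ Real.log β := Real.log_nonneg hβ1
  have hY0 : 0 ≤ β ^ (4 * θ) := Real.rpow_nonneg hβ0.le _
  have h3 : (#Λ : ℝ) * Real.log a ≤ 2500 * β ^ (4 * θ) * (|Real.log c| + 3 / 2 * Real.log β) := by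
    calc (#Λ : ℝ) * Real.log a ≤ #Λ * (|Real.log c| + 3 / 2 * Real.log β) :=
          mul_le_mul_of_nonneg_left hloga (Nat.cast_nonneg _)
      _ ≤ 2500 * β ^ (4 * θ) * (|Real.log c| + 3 / 2 * Real.log β) :=
          mul_le_mul_of_nonneg_right hΛR (by positivity)
  have h4 := hasy β hβ
  nlinarith [h3, h4, hΛ'R, abs_nonneg (Real.log c)]

end SU2Box

end Summit.QuantumFields.YangMills.Theorems.WeakCouplingRates

end
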